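import Summits.QuantumFields.BalabanUV.T4Continuum.Support.ShellMeasureCommutatorVariation
import Literature.MathematicalPhysics.QuantumFieldTheory.Balaban1983to89.B8Eq186AdCommutator

/-!
# `T4Continuum.ShellMeasureCommutatorByParts` — WALL §2 (a) item (P4), THE ∇-PART (row S65 f3, file 2∕3): LOCALITY of
# the single-bond variation off the star, and the POINTWISE SUMMATION BY PARTS — for a TRACIAL `τ` and ANY plaquette
# function `F`, `Σ_{p ∈ st(b)} τ((D^η_{U₀} ι_bX)(p)·F(p)) = τ(X·(D^{η*}_{U₀}F)_κ(y))` with b08's `pdiv` = B8 (1.2) =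
# [B9] (3.9): the bump's `η⁻¹` IS the adjoint derivative's `η⁻¹` (cell `pub-balaban`, sub-cell `t4`, NE7c (node U5b);
# unit `b2b-balaban-t4-ne7c-formalise-leaf-05` gen 7; row S65 f3; ADDITIVE — imports file 1 `ShellMeasureCommutatorVariation`
# and b08's `B8Eq186AdCommutator` (for its `adR_zero_right`) ONLY; [folklore]; 0 def, 0 sorry)

HONEST FRAMING.  Finite four-torus programme, rung (B)+1 only — NOT infinite volume, NOT a mass gap, NOT the Clay
problem, NOT summit progress; (B), `BetaPertHyp`, (B^μ) are not consumed.  NE7c (`T4IndicatorShell.ShellWeightBound`)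
is NOT PRINTED and NOT PROVED; «NE7c ⇐ the named binders» (WALL `t4/b2b-balaban-t4-ne7c-p1/WALL-NE7c-P1.md` §2).
ELEMENTARY covariant lattice calculus ([folklore]) over the b08 lineage's KERNEL modules (`B8Ineq132`,
`B8Eq143PlaqExpansion`, `B8Eq146AExpansion`, `B8Eq151V2Divergence`: the covariant derivatives (1.1) = [B9] (3.3)∕(3.8),
the plaquette covariant derivative [B9] (3.4), the adjoint divergence (1.2) = [B9] (3.9), the bracket `{…}` of (1.49)∕
(1.50), and the kernel theorems (1.50)–(1.53)); [Balaban1985Variational] (cell paper B11) p. 284 (39) and p. 292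
(91)–(96) are LOCATORS for the SHAPE only — the paper is under adjudication (ABSOLUTE RULE), nothing printed is asserted
or cited as a fact; no `def … : Prop` is minted (the `def`s are DATA).  HONEST DEPENDENCY (cell): continuum YM on T⁴ ⇐
BetaPertH ∧ nine spine estimates (0/9 proved); BetaPertH ⇐ (D1) ∧ (D4) ∧ CAP+tail; G-an2-4 gates asym, D1 and NE2/3/4.

THE POINT (owner census gen 29, locator `HOME/b2b-balaban-t4-ne7c-formalise-leaf-02/XREAD-P4-B11-SectB.md` of row S65):
END-II's (P4) binder `hW : ∀ V, Prop4Hyp (W𝒱 V) C₄ a₃` = B11 Prop. 4 (97)∕(98).  At the live levels `Ω_j`, `j ≥ 1`, the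
naive one-plaquette Taylor bound «in |A′| alone» loses EXACTLY a factor `Lʲ`, and only where `δ∕δA′(b)` hits the
`(DA′)(p)` slot of (39)'s first term `¼ i tr[(DA)(p)·Σ_{b₁<b₂⊂∂p} i[A′(b₁), A′(b₂)]]`: the single-bond variation of the
curl is `±η⁻¹R(…)X`, so the naive bound of that slot is `O(1)·η⁻¹·|A′|²`.  Print's repair, p. 292 (93) + [6] (1.52) =
(96): sum by parts — the `η⁻¹` becomes the ADJOINT derivative `D^{η*}` of the bracket, and `D^{η*}{…}` is `O(|A||∇A|)`
by the product rule (1.52) because every term of `{…}` beyond `2[A_μ, A_ν]` CARRIES an `η` ((1.50): «we use these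
factors to cancel η⁻¹») — «estimated by O(1)|∇A′||A′|».  This three-file set (`…CommutatorVariation` →
`…CommutatorByParts` → `…CommutatorGradient`) types that MECHANISM at ONE GRID of spacing `η` with the two scales
DISPLAYED as plain sup bounds `|B(b)| ≤ a`, `|∇^η_{U₀}B| ≤ G` (at level j: `a ∝ (Lʲη)⁻¹`, `G ∝ (Lʲη)⁻²` — the (98)
packaging in the weighted norms is row S65 f2's, not made here).

WHAT THIS FILE PROVES (kernel; the only hypotheses are `μ < ν`, `p ∉ st(b)`, and traciality `τ(PQ) = τ(QP)`):
* §1 OFF THE STAR the bump is invisible: `X?_bump_eq_zero`, `plaqCovDeriv_bump_eq_zero`, `dbrk_bump_eq_zero`,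
  **`dcub_bump_eq_zero`** — the display (90) «only st(b) contributes»; ON THE STAR the four values of
  `Σᵢxᵢ(ι_bX)`: `X`, `−R(U₀(y − e_ν, ν))X`, `R(U₀(y − e_μ, μ))X`, `−X` (`lin_bump₁…₄`).
* §2 `tr_conjR_mul` (traciality moves a transport across the pairing: `τ(R(u)X·F) = τ(X·R(u⁻¹)F)`), the two family
  identities `fam_gt` ∕ `fam_lt`, and **`sum_plaqStar_tr_plaqCovDeriv_bump`**:
  `Σ_{p ∈ plaqStar y κ} τ((D^η_{U₀}(bump y κ X))(p)·F(p)) = τ(X·pdiv η U₀ F κ y)` — [B9] p. 392's «the adjoint operator D*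
  is acting on functions defined at bonds … (3.8)–(3.9)» in pointwise form, signs and transports exactly as b08's
  definitions force them, for every `η` (`η = 0` included, by the junk conventions).
File 3 `ShellMeasureCommutatorGradient`: the bound.
NOT HERE (said in every headline): the identification of the cubic commutator functional with the order-3 part of the
actual one-grid Wilson action (row S65 f4, leaf-03: «ord₃ = −½τ(Y·K) + V₀′»), the weighted multi-grid norms and the (98)
packaging (S65 f2a∕f2b, leaf-02), the `HD`-dressed variants `A″ = A′ − HD(A′)` of (91)–(96) with (46)'s second clause
(S66), the torus packaging, the [dict] (node O); NE7c NOT proved; 0/9 spine.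
-/

noncomputable section

open scoped BigOperators
open NormedSpace Finset

namespace Summit.QuantumFields.BalabanUV.T4Continuum.ShellMeasureCommutatorByParts

open Literature.MathematicalPhysics.QuantumFieldTheory.Balaban1983to89
open B7Prop1Explicit (e)
open B7Eq78Linearization (conjR conjR_apply conjR_add conjR_sub conjR_smul)
open B8Ineq132 (covDeriv)
open B8Eq143PlaqExpansion (pdiv)
open B8Eq146AExpansion (X1 X2 X3 X4 lin adR plaqCovDeriv conjR_neg)
open B8Eq151V2Divergence (brk)
open B8Eq186AdCommutator (adR_zero_right)
open ShellMeasureCommutatorVariation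

export B7Prop1Explicit (Site)

variable {d : ℕ}

/-! ## §1 Locality off the star; the four values on the star -/

section StarRing

variable {𝔸 : Type*} [NormedRing 𝔸]

/-- OFF THE STAR the bump is invisible to the first plaquette variable. [folklore] -/
theorem X1_bump_eq_zero {y x : Site d} {κ μ ν : Fin d} (hμν : μ < ν) (h : (μ, ν, x) ∉ plaqStar y κ) (X : 𝔸) :
    X1 (bump y κ X) μ x = 0 := by
  rw [X1, bump_of_ne]
  rintro ⟨rfl, rfl⟩
  exact h (mem_plaqStar₁ hμν)

/-- … to the second. [folklore] -/
theorem X2_bump_eq_zero (U₀ : Site d → Fin d → 𝔸ˣ) {y x : Site d} {κ μ ν : Fin d} (hμν : μ < ν)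
    (h : (μ, ν, x) ∉ plaqStar y κ) (X : 𝔸) : X2 U₀ (bump y κ X) μ ν x = 0 := by
  rw [X2, bump_of_ne]
  · simp [conjR_apply]
  rintro ⟨hx, rfl⟩
  have hx' : x = y - e μ := by rw [← hx]; simp
  subst hx'
  exact h (mem_plaqStar₃ hμν)

/-- … to the third. [folklore] -/
theorem X3_bump_eq_zero (U₀ : Site d → Fin d → 𝔸ˣ) {y x : Site d} {κ μ ν : Fin d} (hμν : μ < ν)
    (h : (μ, ν, x) ∉ plaqStar y κ) (X : 𝔸) : X3 U₀ (bump y κ X) μ ν x = 0 := by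
  rw [X3, bump_of_ne]
  · simp [conjR_apply]
  rintro ⟨hx, rfl⟩
  have hx' : x = y - e ν := by rw [← hx]; simp
  subst hx'
  exact h (mem_plaqStar₂ hμν)

/-- … and to the fourth. [folklore] -/
theorem X4_bump_eq_zero {y x : Site d} {κ μ ν : Fin d} (hμν : μ < ν) (h : (μ, ν, x) ∉ plaqStar y κ) (X : 𝔸) :
    X4 (bump y κ X) ν x = 0 := by
  rw [X4, bump_of_ne, neg_zero]
  rintro ⟨rfl, rfl⟩
  exact h (mem_plaqStar₄ hμν)

/-- `[0, Y] = 0`. [folklore] -/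
theorem adR_zero_left (Y : 𝔸) : adR 0 Y = 0 := by simp [adR]

/-- LOCALITY of the bracket's variation: `δ{…}(B)[ι_bX](p) = 0` for `p ∉ st(b)`. [folklore] -/
theorem dbrk_bump_eq_zero (U₀ : Site d → Fin d → 𝔸ˣ) (B : Site d → Fin d → 𝔸) {y x : Site d} {κ μ ν : Fin d}
    (hμν : μ < ν) (h : (μ, ν, x) ∉ plaqStar y κ) (X : 𝔸) : dbrk U₀ B (bump y κ X) μ ν x = 0 := by
  simp only [dbrk, X1_bump_eq_zero hμν h, X2_bump_eq_zero U₀ hμν h, X3_bump_eq_zero U₀ hμν h,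
    X4_bump_eq_zero hμν h, adR_zero_left, adR_zero_right, add_zero]

/-- THE FOUR VALUES OF `Σᵢxᵢ(ι_bX)` ON THE STAR — first family: `X`. [folklore] -/
theorem lin_bump₁ (U₀ : Site d → Fin d → 𝔸ˣ) (y : Site d) {κ ν : Fin d} (h : κ < ν) (X : 𝔸) :
    lin U₀ (bump y κ X) κ ν y = X := by
  have h1 : ν ≠ κ := ne_of_gt h
  have e2 : ¬(y + e κ = y ∧ ν = κ) := fun hh => h1 hh.2
  have e3 : ¬(y + e ν = y ∧ κ = κ) := fun hh => add_e_ne y ν hh.1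
  have e4 : ¬(y = y ∧ ν = κ) := fun hh => h1 hh.2
  simp only [lin, X1, X2, X3, X4, bump_self, bump_of_ne e2, bump_of_ne e3, bump_of_ne e4, neg_zero, add_zero]
  simp [conjR_apply]

/-- — second family: `−R(U₀(y − e_ν, ν))X`. [folklore] -/
theorem lin_bump₂ (U₀ : Site d → Fin d → 𝔸ˣ) (y : Site d) {κ ν : Fin d} (h : κ < ν) (X : 𝔸) :
    lin U₀ (bump y κ X) κ ν (y - e ν) = -conjR (U₀ (y - e ν) ν) X := by
  have h1 : ν ≠ κ := ne_of_gt h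
  have e1 : ¬(y - e ν = y ∧ κ = κ) := fun hh => sub_e_ne y ν hh.1
  have e2 : ¬(y - e ν + e κ = y ∧ ν = κ) := fun hh => h1 hh.2
  have e4 : ¬(y - e ν = y ∧ ν = κ) := fun hh => h1 hh.2
  simp only [lin, X1, X2, X3, X4, bump_of_ne e1, bump_of_ne e2, bump_of_ne e4, neg_zero, add_zero, zero_add]
  rw [show bump y κ X (y - e ν + e ν) κ = X by simp [bump], conjR_neg]
  simp [conjR_apply]

/-- — third family: `R(U₀(y − e_μ, μ))X`. [folklore] -/
theorem lin_bump₃ (U₀ : Site d → Fin d → 𝔸ˣ) (y : Site d) {κ μ : Fin d} (h : μ < κ) (X : 𝔸) :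
    lin U₀ (bump y κ X) μ κ (y - e μ) = conjR (U₀ (y - e μ) μ) X := by
  have h1 : μ ≠ κ := ne_of_lt h
  have e1 : ¬(y - e μ = y ∧ μ = κ) := fun hh => h1 hh.2
  have e3 : ¬(y - e μ + e κ = y ∧ μ = κ) := fun hh => h1 hh.2
  have e4 : ¬(y - e μ = y ∧ κ = κ) := fun hh => sub_e_ne y μ hh.1
  simp only [lin, X1, X2, X3, X4, bump_of_ne e1, bump_of_ne e3, bump_of_ne e4, neg_zero, add_zero, zero_add]
  rw [show bump y κ X (y - e μ + e μ) κ = X by simp [bump]]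
  simp [conjR_apply]

/-- — fourth family: `−X`. [folklore] -/
theorem lin_bump₄ (U₀ : Site d → Fin d → 𝔸ˣ) (y : Site d) {κ μ : Fin d} (h : μ < κ) (X : 𝔸) :
    lin U₀ (bump y κ X) μ κ y = -X := by
  have h1 : μ ≠ κ := ne_of_lt h
  have e1 : ¬(y = y ∧ μ = κ) := fun hh => h1 hh.2
  have e2 : ¬(y + e μ = y ∧ κ = κ) := fun hh => add_e_ne y μ hh.1
  have e3 : ¬(y + e κ = y ∧ μ = κ) := fun hh => h1 hh.2
  simp only [lin, X1, X2, X3, X4, bump_of_ne e1, bump_of_ne e2, bump_of_ne e3, bump_self, neg_zero, zero_add]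
  simp [conjR_apply]

end StarRing

/-! ## §2 The pointwise summation by parts -/

section StarAlg

variable {𝔸 : Type*} [NormedRing 𝔸] [NormedAlgebra ℂ 𝔸]

/-- LOCALITY of the plaquette covariant derivative: `(D^η_{U₀} ι_bX)(p) = 0` for `p ∉ st(b)`. [folklore] -/
theorem plaqCovDeriv_bump_eq_zero (η : ℝ) (U₀ : Site d → Fin d → 𝔸ˣ) {y x : Site d} {κ μ ν : Fin d}
    (hμν : μ < ν) (h : (μ, ν, x) ∉ plaqStar y κ) (X : 𝔸) : plaqCovDeriv η U₀ (bump y κ X) μ ν x = 0 := by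
  simp only [plaqCovDeriv, lin, X1_bump_eq_zero hμν h, X2_bump_eq_zero U₀ hμν h, X3_bump_eq_zero U₀ hμν h,
    X4_bump_eq_zero hμν h, add_zero, smul_zero]

/-- LOCALITY of the first variation: `dcub(B)[ι_bX](p) = 0` for `p ∉ st(b)` — the display (90) «only st(b)
contributes». [folklore] -/
theorem dcub_bump_eq_zero (w : ℂ) (tr : 𝔸 →L[ℂ] ℂ) (η : ℝ) (U₀ : Site d → Fin d → 𝔸ˣ) (B : Site d → Fin d → 𝔸)
    {y x : Site d} {κ μ ν : Fin d} (hμν : μ < ν) (h : (μ, ν, x) ∉ plaqStar y κ) (X : 𝔸) :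
    dcub w tr η U₀ B (bump y κ X) μ ν x = 0 := by
  simp only [dcub, plaqCovDeriv_bump_eq_zero η U₀ hμν h, dbrk_bump_eq_zero U₀ B hμν h, zero_mul, mul_zero,
    add_zero, map_zero]

/-- TRACIALITY moves a transport across the pairing: `τ(R(u)X · F) = τ(X · R(u⁻¹)F)`. [folklore] -/
theorem tr_conjR_mul {tr : 𝔸 →L[ℂ] ℂ} (htr : ∀ P Q : 𝔸, tr (P * Q) = tr (Q * P)) (u : 𝔸ˣ) (X F : 𝔸) :
    tr (conjR u X * F) = tr (X * conjR u⁻¹ F) := by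
  rw [conjR_apply, conjR_apply, inv_inv]
  calc tr ((u : 𝔸) * X * ((u⁻¹ : 𝔸ˣ) : 𝔸) * F) = tr ((u : 𝔸) * (X * ((u⁻¹ : 𝔸ˣ) : 𝔸) * F)) := by
        simp only [mul_assoc]
    _ = tr (X * ((u⁻¹ : 𝔸ˣ) : 𝔸) * F * (u : 𝔸)) := htr _ _
    _ = tr (X * (((u⁻¹ : 𝔸ˣ) : 𝔸) * F * (u : 𝔸))) := by simp only [mul_assoc]

/-- Summation by parts, the family `ν > κ`: the two plaquettes `p_{κν}(y)`, `p_{κν}(y − e_ν)` give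
`−τ(X · (D^{η*}_{U₀,ν}F_{κν})(y))`. [folklore] -/
theorem fam_gt {η : ℝ} {tr : 𝔸 →L[ℂ] ℂ} (htr : ∀ P Q : 𝔸, tr (P * Q) = tr (Q * P))
    (U₀ : Site d → Fin d → 𝔸ˣ) (F : Fin d → Fin d → Site d → 𝔸) (y : Site d) {κ ν : Fin d} (h : κ < ν) (X : 𝔸) :
    tr (plaqCovDeriv η U₀ (bump y κ X) κ ν y * F κ ν y)
      + tr (plaqCovDeriv η U₀ (bump y κ X) κ ν (y - e ν) * F κ ν (y - e ν))
      = -tr (X * covDeriv η U₀ ν (F κ ν) y) := by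
  rw [plaqCovDeriv, plaqCovDeriv, lin_bump₁ U₀ y h, lin_bump₂ U₀ y h, covDeriv]
  rw [← Complex.coe_smul, ← Complex.coe_smul, ← Complex.coe_smul]
  simp only [smul_mul_assoc, mul_smul_comm, map_smul, smul_eq_mul, neg_mul, map_neg, mul_neg, mul_sub, map_sub,
    tr_conjR_mul htr]
  ring

/-- Summation by parts, the family `μ < κ`: the two plaquettes `p_{μκ}(y − e_μ)`, `p_{μκ}(y)` give
`τ(X · (D^{η*}_{U₀,μ}F_{μκ})(y))`. [folklore] -/
theorem fam_lt {η : ℝ} {tr : 𝔸 →L[ℂ] ℂ} (htr : ∀ P Q : 𝔸, tr (P * Q) = tr (Q * P))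
    (U₀ : Site d → Fin d → 𝔸ˣ) (F : Fin d → Fin d → Site d → 𝔸) (y : Site d) {κ μ : Fin d} (h : μ < κ) (X : 𝔸) :
    tr (plaqCovDeriv η U₀ (bump y κ X) μ κ (y - e μ) * F μ κ (y - e μ))
      + tr (plaqCovDeriv η U₀ (bump y κ X) μ κ y * F μ κ y)
      = tr (X * covDeriv η U₀ μ (F μ κ) y) := by
  rw [plaqCovDeriv, plaqCovDeriv, lin_bump₃ U₀ y h, lin_bump₄ U₀ y h, covDeriv]
  rw [← Complex.coe_smul, ← Complex.coe_smul, ← Complex.coe_smul]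
  simp only [smul_mul_assoc, mul_smul_comm, map_smul, smul_eq_mul, neg_mul, map_neg, mul_neg, mul_sub, map_sub,
    tr_conjR_mul htr]
  ring

/-- **POINTWISE SUMMATION BY PARTS.**  For a TRACIAL functional `τ` and ANY plaquette function `F`, the star-sum of
`τ((D^η_{U₀} ι_bX)(p) · F(p))` over `st(b)`, `b = ⟨y, y + e_κ⟩`, equals `τ(X · (D^{η*}_{U₀}F)_κ(y))` with b08's
`pdiv` = B8 (1.2) = B9 (3.9): the bump's `η⁻¹` IS the adjoint derivative's `η⁻¹` — «the derivative never lands on a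
bare η⁻¹». [folklore] -/
theorem sum_plaqStar_tr_plaqCovDeriv_bump (η : ℝ) {tr : 𝔸 →L[ℂ] ℂ} (htr : ∀ P Q : 𝔸, tr (P * Q) = tr (Q * P))
    (U₀ : Site d → Fin d → 𝔸ˣ) (F : Fin d → Fin d → Site d → 𝔸) (y : Site d) (κ : Fin d) (X : 𝔸) :
    ∑ p ∈ plaqStar y κ, tr (plaqCovDeriv η U₀ (bump y κ X) p.1 p.2.1 p.2.2 * F p.1 p.2.1 p.2.2) =
      tr (X * pdiv η U₀ F κ y) := by
  rw [sum_plaqStar (fun p : Fin d × Fin d × Site d =>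
    tr (plaqCovDeriv η U₀ (bump y κ X) p.1 p.2.1 p.2.2 * F p.1 p.2.1 p.2.2)) y κ]
  dsimp only
  rw [sum_congr rfl fun ν hν => fam_gt htr U₀ F y (mem_Ioi.1 hν) X,
    sum_congr rfl fun μ hμ => fam_lt htr U₀ F y (mem_Iio.1 hμ) X,
    pdiv, mul_sub, map_sub, mul_sum, mul_sum, map_sum, map_sum, sum_neg_distrib]
  abel

end StarAlg

end Summit.QuantumFields.BalabanUV.T4Continuum.ShellMeasureCommutatorByParts

end
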